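import Summits.AnomalousDissipation.AnomalousDissipation.Theorems.SawtoothPulseCascadeK1LocalisedCascadeFlatCurvature
import Summits.AnomalousDissipation.AnomalousDissipation.Theorems.SawtoothPulseCascadeK1LocalisedCascadeStripCutoff

/-!
# K1loc, line `Spectral` / SeqCone — helper: `ε`-FREE DERIVATIVE BOUNDS FOR THE STRIP CUT-OFFS OF THE CASCADE (S-B data)

Helper file of the prover lane on the crux `K1LocalisedCascade` (stmt-AnomalousDissipation-19491), route
`SawtoothPulseCascade` (glue seat k1loc-p3; sequel of `…FlatCurvature`).  Transport of the flat-curvature lemma to the cascade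
profile `U_j(y) = S_{δ_j}(2πN_j y)/(2πN_j)` and to the strip cut-offs `X = sT((W − (1−2ε))/ε)` of `…StripCutoff`
(`W = U_j′` for the `+` family, `W = −U_j′` for the `−` family):
* `abs_deriv2_U_le_of_slope` / `abs_deriv3_U_le_of_slope` — for all `y`, `M > 0`, `s₀ = ±1`:
  `|U_j″(y)| ≤ (2πN_j/δ_j)[M(1 − s₀U_j′(y)) + (4/M)e^{−M²/2}]`, `|U_j‴(y)| ≤ (2πN_j/δ_j)²[(1+2M²)(1 − s₀U_j′(y)) + (32/M²)e^{−M²/2}]`;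
* `abs_deriv2_U_le_of_layer` / `abs_deriv3_U_le_of_layer` — on `{1 − s₀U_j′ ≤ η}` with `e^{−M²/2} ≤ η`, `M ≥ 1`:
  `|U_j″| ≤ (M+4)(2πN_j/δ_j)η`, `|U_j‴| ≤ (2M²+33)(2πN_j/δ_j)²η`;
* `abs_deriv_cutoff_le_of_layer` / `abs_deriv_deriv_cutoff_le_of_layer` — for ANY differentiable `W`: if `|W′| ≤ L₁`
  (`|W″| ≤ L₂`) on the closed layer `{1−2ε ≤ W ≤ 1−ε}`, then `|X′| ≤ C₁L₁/ε` and `|X″| ≤ C₂L₁²/ε² + C₁L₂/ε` EVERYWHERE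
  (off the layer `sT′`, `sT″` vanish);
* `abs_deriv_cutoff_deriv_U_le_of_layer` / `abs_deriv_deriv_cutoff_deriv_U_le_of_layer` (and `_neg_` twins) — the cascade
  cut-offs: `|X^±_j′| ≤ 2C₁(M+4)(2πN_j/δ_j)`, `|X^±_j″| ≤ (4C₂(M+4)² + 2C₁(2M²+33))(2πN_j/δ_j)²` whenever `e^{−M²/2} ≤ 2ε`,
  `M ≥ 1` — INDEPENDENT of `ε` (compare `…MultiplierConstants`: `k!·C·(4πN_j/(δ_jε))ᵏ`), so the cut-off width `ε_j` may decay
  geometrically at the price `M_j ∝ √j`.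
No definitions; no statement about the stub.  [cite: Folland1999, §8.2 Prop. 8.10 and Prop. 2.53] [problem: turb]
-/

-- `Summit.<Summit>.<Problem>`: single-conjunct summit, the duplicate namespace segment is deliberate.
set_option linter.dupNamespace false

noncomputable section

namespace Summit.AnomalousDissipation.AnomalousDissipation.Theorems.SawtoothPulseCascade.K1Flat

open MeasureTheory Set Filter Topology Real
open Literature.Analysis.FluidPDE.SawtoothCascade Literature.Analysis.FluidPDE.SawtoothCascade.CascadeParams
open Literature.Analysis.Calculus (differentiable_smoothTransition deriv_smoothTransition_of_nonpos
  deriv_smoothTransition_of_one_le deriv_deriv_smoothTransition_eq_zero_off_Icc contDiff_deriv_smoothTransition)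
open Summit.AnomalousDissipation.AnomalousDissipation.Theorems.SawtoothPulseCascade.K1Cutoff

/-! ## §1 The cascade profile -/

variable (P : CascadeParams)

/-- **Flat curvature of the cascade profile**: `|U_j″(y)| ≤ (2πN_j/δ_j)[M(1 − s₀U_j′(y)) + (4/M)e^{−M²/2}]` for all `y`
(`δ_j > 0`, `M > 0`, `s₀ = ±1`). [cite: Folland1999, §8.2 Prop. 8.10 and Prop. 2.53] -/
theorem abs_deriv2_U_le_of_slope {j : ℕ} (hδ : 0 < P.δ j) {M : ℝ} (hM : 0 < M) {s₀ : ℝ} (hs₀ : s₀ = 1 ∨ s₀ = -1) (y : ℝ) :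
    |deriv (deriv (P.U j)) y| ≤
      (2 * Real.pi * P.N j / P.δ j) * (M * (1 - s₀ * deriv (P.U j) y) + 4 / M * Real.exp (-(M ^ 2 / 2))) := by
  rcases eq_or_ne (P.N j) 0 with hN | hN
  · have hfun : P.U j = fun _ => 0 := by funext y; simp [CascadeParams.U, hN]
    rw [hfun]; simp [hN]
  · have hc : 0 < 2 * Real.pi * (P.N j : ℝ) := by
      have : (0 : ℝ) < P.N j := by exact_mod_cast Nat.pos_of_ne_zero hN
      positivity
    rw [(P.hasDerivAt_deriv_U hδ hN y).deriv, abs_mul, abs_of_pos hc, congrFun (P.deriv_U_eq hδ hN) y]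
    have h := abs_deriv2_roundedSaw_le_of_slope hδ hM hs₀ (2 * Real.pi * P.N j * y)
    calc |deriv (deriv (roundedSaw (P.δ j))) (2 * Real.pi * P.N j * y)| * (2 * Real.pi * P.N j)
        ≤ (M / P.δ j * (1 - s₀ * deriv (roundedSaw (P.δ j)) (2 * Real.pi * P.N j * y)) +
            4 / (M * P.δ j) * Real.exp (-(M ^ 2 / 2))) * (2 * Real.pi * P.N j) := mul_le_mul_of_nonneg_right h hc.le
      _ = _ := by field_simp

/-- **Flat third derivative of the cascade profile**:
`|U_j‴(y)| ≤ (2πN_j/δ_j)²[(1+2M²)(1 − s₀U_j′(y)) + (32/M²)e^{−M²/2}]` for all `y` (`δ_j > 0`, `M > 0`, `s₀ = ±1`).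
[cite: Folland1999, §8.2 Prop. 8.10 and Prop. 2.53] -/
theorem abs_deriv3_U_le_of_slope {j : ℕ} (hδ : 0 < P.δ j) {M : ℝ} (hM : 0 < M) {s₀ : ℝ} (hs₀ : s₀ = 1 ∨ s₀ = -1) (y : ℝ) :
    |deriv (deriv (deriv (P.U j))) y| ≤
      (2 * Real.pi * P.N j / P.δ j) ^ 2 *
        ((1 + 2 * M ^ 2) * (1 - s₀ * deriv (P.U j) y) + 32 / M ^ 2 * Real.exp (-(M ^ 2 / 2))) := by
  rcases eq_or_ne (P.N j) 0 with hN | hN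
  · have hfun : P.U j = fun _ => 0 := by funext y; simp [CascadeParams.U, hN]
    rw [hfun]; simp [hN]
  · have hc : 0 < 2 * Real.pi * (P.N j : ℝ) := by
      have : (0 : ℝ) < P.N j := by exact_mod_cast Nat.pos_of_ne_zero hN
      positivity
    rw [congrFun (P.deriv3_U_eq hδ hN) y, abs_mul, abs_mul, abs_of_pos hc, congrFun (P.deriv_U_eq hδ hN) y]
    have h := abs_deriv3_roundedSaw_le_of_slope hδ hM hs₀ (2 * Real.pi * P.N j * y)
    have hc2 : 0 ≤ (2 * Real.pi * (P.N j : ℝ)) * (2 * Real.pi * P.N j) := by positivity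
    calc |deriv (deriv (deriv (roundedSaw (P.δ j)))) (2 * Real.pi * P.N j * y)| * (2 * Real.pi * P.N j) * (2 * Real.pi * P.N j)
        = |deriv (deriv (deriv (roundedSaw (P.δ j)))) (2 * Real.pi * P.N j * y)| *
            ((2 * Real.pi * P.N j) * (2 * Real.pi * P.N j)) := by ring
      _ ≤ ((1 + 2 * M ^ 2) / P.δ j ^ 2 * (1 - s₀ * deriv (roundedSaw (P.δ j)) (2 * Real.pi * P.N j * y)) +
            32 / (M ^ 2 * P.δ j ^ 2) * Real.exp (-(M ^ 2 / 2))) * ((2 * Real.pi * P.N j) * (2 * Real.pi * P.N j)) :=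
          mul_le_mul_of_nonneg_right h hc2
      _ = _ := by field_simp

/-- **On the flat layer**: if `1 − s₀U_j′(y) ≤ η`, `e^{−M²/2} ≤ η` and `M ≥ 1` then `|U_j″(y)| ≤ (M + 4)(2πN_j/δ_j)·η`.
[cite: Folland1999, §8.2 Prop. 8.10 and Prop. 2.53] -/
theorem abs_deriv2_U_le_of_layer {j : ℕ} (hδ : 0 < P.δ j) {M η : ℝ} (hM : 1 ≤ M) (hMη : Real.exp (-(M ^ 2 / 2)) ≤ η)
    {s₀ : ℝ} (hs₀ : s₀ = 1 ∨ s₀ = -1) {y : ℝ} (hy : 1 - s₀ * deriv (P.U j) y ≤ η) :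
    |deriv (deriv (P.U j)) y| ≤ (M + 4) * (2 * Real.pi * P.N j / P.δ j) * η := by
  have hM0 : 0 < M := by linarith
  have hΛ : 0 ≤ 2 * Real.pi * (P.N j : ℝ) / P.δ j := by positivity
  have hη0 : 0 ≤ η := (Real.exp_pos _).le.trans hMη
  refine (abs_deriv2_U_le_of_slope P hδ hM0 hs₀ y).trans ?_
  have h1 : M * (1 - s₀ * deriv (P.U j) y) ≤ M * η := mul_le_mul_of_nonneg_left hy hM0.le
  have h2 : 4 / M * Real.exp (-(M ^ 2 / 2)) ≤ 4 * η := by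
    calc 4 / M * Real.exp (-(M ^ 2 / 2)) ≤ 4 / M * η := mul_le_mul_of_nonneg_left hMη (by positivity)
      _ ≤ 4 * η := by
          refine mul_le_mul_of_nonneg_right ?_ hη0
          rw [div_le_iff₀ hM0]; nlinarith
  nlinarith [mul_le_mul_of_nonneg_left (add_le_add h1 h2) hΛ]

/-- **On the flat layer, third derivative**: if `1 − s₀U_j′(y) ≤ η`, `e^{−M²/2} ≤ η` and `M ≥ 1` then
`|U_j‴(y)| ≤ (2M² + 33)(2πN_j/δ_j)²·η`. [cite: Folland1999, §8.2 Prop. 8.10 and Prop. 2.53] -/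
theorem abs_deriv3_U_le_of_layer {j : ℕ} (hδ : 0 < P.δ j) {M η : ℝ} (hM : 1 ≤ M) (hMη : Real.exp (-(M ^ 2 / 2)) ≤ η)
    {s₀ : ℝ} (hs₀ : s₀ = 1 ∨ s₀ = -1) {y : ℝ} (hy : 1 - s₀ * deriv (P.U j) y ≤ η) :
    |deriv (deriv (deriv (P.U j))) y| ≤ (2 * M ^ 2 + 33) * (2 * Real.pi * P.N j / P.δ j) ^ 2 * η := by
  have hM0 : 0 < M := by linarith
  have hΛ : 0 ≤ (2 * Real.pi * (P.N j : ℝ) / P.δ j) ^ 2 := by positivity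
  have hη0 : 0 ≤ η := (Real.exp_pos _).le.trans hMη
  refine (abs_deriv3_U_le_of_slope P hδ hM0 hs₀ y).trans ?_
  have h1 : (1 + 2 * M ^ 2) * (1 - s₀ * deriv (P.U j) y) ≤ (1 + 2 * M ^ 2) * η :=
    mul_le_mul_of_nonneg_left hy (by positivity)
  have h2 : 32 / M ^ 2 * Real.exp (-(M ^ 2 / 2)) ≤ 32 * η := by
    calc 32 / M ^ 2 * Real.exp (-(M ^ 2 / 2)) ≤ 32 / M ^ 2 * η := mul_le_mul_of_nonneg_left hMη (by positivity)
      _ ≤ 32 * η := by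
          refine mul_le_mul_of_nonneg_right ?_ hη0
          rw [div_le_iff₀ (by positivity)]; nlinarith
  nlinarith [mul_le_mul_of_nonneg_left (add_le_add h1 h2) hΛ]

/-! ## §2 Strip cut-offs with slope control only on the layer -/

/-- **`ε`-free first-derivative bound for the strip cut-off.**  Let `W` be differentiable and `|W′| ≤ L₁` on the closed layer
`{1 − 2ε ≤ W ≤ 1 − ε}` (`L₁ ≥ 0`).  Then `X = sT((W − (1−2ε))/ε)` satisfies `|X′(y)| ≤ C₁L₁/ε` for EVERY `y` (`ε > 0`, `C₁` a
bound of `|sT′|`): off the layer `sT′` vanishes. [folklore] -/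
theorem abs_deriv_cutoff_le_of_layer {W : ℝ → ℝ} (hW : Differentiable ℝ W) {ε C₁ L₁ : ℝ} (hε : 0 < ε)
    (hC₁ : ∀ x, |deriv smoothTransition x| ≤ C₁) (hL₁ : 0 ≤ L₁)
    (hL : ∀ y, 1 - 2 * ε ≤ W y → W y ≤ 1 - ε → |deriv W y| ≤ L₁) (y : ℝ) :
    |deriv (fun y => smoothTransition ((W y - (1 - 2 * ε)) / ε)) y| ≤ C₁ * L₁ / ε := by
  have hC₁0 : 0 ≤ C₁ := (abs_nonneg _).trans (hC₁ 0)
  rw [(hasDerivAt_cutoff (hW y).hasDerivAt).deriv]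
  by_cases hlay : 1 - 2 * ε ≤ W y ∧ W y ≤ 1 - ε
  · rw [abs_mul, abs_div, abs_of_pos hε]
    calc |deriv smoothTransition ((W y - (1 - 2 * ε)) / ε)| * (|deriv W y| / ε) ≤ C₁ * (L₁ / ε) :=
          mul_le_mul (hC₁ _) (div_le_div_of_nonneg_right (hL y hlay.1 hlay.2) hε.le) (by positivity) hC₁0
      _ = C₁ * L₁ / ε := by ring
  · have hz : deriv smoothTransition ((W y - (1 - 2 * ε)) / ε) = 0 := by
      rw [not_and_or, not_le, not_le] at hlay
      rcases hlay with h | h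
      · exact deriv_smoothTransition_of_nonpos (div_nonpos_of_nonpos_of_nonneg (by linarith) hε.le)
      · exact deriv_smoothTransition_of_one_le (by rw [le_div_iff₀ hε]; linarith)
    rw [hz, zero_mul, abs_zero]; positivity

/-- **`ε`-free second-derivative bound for the strip cut-off.**  Let `W` be twice differentiable with `|W′| ≤ L₁` and
`|W″| ≤ L₂` on the closed layer `{1 − 2ε ≤ W ≤ 1 − ε}`.  Then `|X″(y)| ≤ C₂L₁²/ε² + C₁L₂/ε` for every `y`.
[folklore] -/
theorem abs_deriv_deriv_cutoff_le_of_layer {W : ℝ → ℝ} (hW : Differentiable ℝ W) (hW2 : Differentiable ℝ (deriv W))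
    {ε C₁ C₂ L₁ L₂ : ℝ} (hε : 0 < ε) (hC₁ : ∀ x, |deriv smoothTransition x| ≤ C₁)
    (hC₂ : ∀ x, |deriv (deriv smoothTransition) x| ≤ C₂) (hL₂ : 0 ≤ L₂)
    (hLa : ∀ y, 1 - 2 * ε ≤ W y → W y ≤ 1 - ε → |deriv W y| ≤ L₁)
    (hLb : ∀ y, 1 - 2 * ε ≤ W y → W y ≤ 1 - ε → |deriv (deriv W) y| ≤ L₂) (y : ℝ) :
    |deriv (deriv fun y => smoothTransition ((W y - (1 - 2 * ε)) / ε)) y| ≤ C₂ * L₁ ^ 2 / ε ^ 2 + C₁ * L₂ / ε := by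
  have hC₁0 : 0 ≤ C₁ := (abs_nonneg _).trans (hC₁ 0)
  have hC₂0 : 0 ≤ C₂ := (abs_nonneg _).trans (hC₂ 0)
  by_cases hlay : 1 - 2 * ε ≤ W y ∧ W y ≤ 1 - ε
  · refine (abs_deriv_deriv_cutoff_le hε hW hW2 hC₁ hC₂ y).trans (add_le_add ?_ ?_)
    · rw [div_mul_eq_mul_div, ← sq_abs]
      exact div_le_div_of_nonneg_right (mul_le_mul_of_nonneg_left
        (pow_le_pow_left₀ (abs_nonneg _) (hLa y hlay.1 hlay.2) 2) hC₂0) (by positivity)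
    · rw [div_mul_eq_mul_div]
      exact div_le_div_of_nonneg_right (mul_le_mul_of_nonneg_left (hLb y hlay.1 hlay.2) hC₁0) hε.le
  · rw [(hasDerivAt_deriv_cutoff hW (hW2 y).hasDerivAt).deriv]
    rw [not_and_or, not_le, not_le] at hlay
    have hz1 : deriv smoothTransition ((W y - (1 - 2 * ε)) / ε) = 0 := by
      rcases hlay with h | h
      · exact deriv_smoothTransition_of_nonpos (div_nonpos_of_nonpos_of_nonneg (by linarith) hε.le)
      · exact deriv_smoothTransition_of_one_le (by rw [le_div_iff₀ hε]; linarith)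
    have hz2 : deriv (deriv smoothTransition) ((W y - (1 - 2 * ε)) / ε) = 0 := by
      refine deriv_deriv_smoothTransition_eq_zero_off_Icc _ fun hm => ?_
      rcases hlay with h | h
      · have := hm.1; rw [le_div_iff₀ hε] at this; linarith
      · have := hm.2; rw [div_le_iff₀ hε] at this; linarith
    rw [hz1, hz2, zero_mul, zero_mul, zero_mul, add_zero, abs_zero]; positivity

/-! ## §3 The cascade cut-offs: `ε`-free `D₁`, `D₂` -/

/-- **`ε`-free bound of `X⁺_j′`**: for `W = U_j′`, `0 < ε`, `M ≥ 1` with `e^{−M²/2} ≤ 2ε`: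
`|(sT((U_j′ − (1−2ε))/ε))′(y)| ≤ 2C₁(M + 4)(2πN_j/δ_j)` for every `y` (on the layer `1 − U_j′ ≤ 2ε`, so
`|U_j″| ≤ (M+4)(2πN_j/δ_j)·2ε`). [cite: ElgindiLissMattingly2025, §1 and Rmk. 1.4 (the smoothed pulse profiles)] -/
theorem abs_deriv_cutoff_deriv_U_le_of_layer {j : ℕ} (hδ : 0 < P.δ j) {ε M C₁ : ℝ} (hε : 0 < ε) (hM : 1 ≤ M)
    (hMε : Real.exp (-(M ^ 2 / 2)) ≤ 2 * ε) (hC₁ : ∀ x, |deriv smoothTransition x| ≤ C₁) (y : ℝ) :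
    |deriv (fun y => smoothTransition ((deriv (P.U j) y - (1 - 2 * ε)) / ε)) y| ≤
      2 * C₁ * (M + 4) * (2 * Real.pi * P.N j / P.δ j) := by
  have hdiff : Differentiable ℝ (deriv (P.U j)) := (P.contDiff_deriv_U hδ (n := 1)).differentiable (by simp)
  have hL1 : 0 ≤ (M + 4) * (2 * Real.pi * P.N j / P.δ j) * (2 * ε) := by
    have : 0 ≤ M + 4 := by linarith
    positivity
  have h := abs_deriv_cutoff_le_of_layer hdiff hε hC₁ hL1 (fun z h1 h2 =>
    abs_deriv2_U_le_of_layer P hδ hM hMε (s₀ := 1) (Or.inl rfl) (by linarith)) y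
  calc _ ≤ _ := h
    _ = 2 * C₁ * (M + 4) * (2 * Real.pi * P.N j / P.δ j) := by field_simp

/-- The same for the `−` family `W = −U_j′`. [cite: ElgindiLissMattingly2025, §1 and Rmk. 1.4 (the smoothed pulse profiles)] -/
theorem abs_deriv_cutoff_neg_deriv_U_le_of_layer {j : ℕ} (hδ : 0 < P.δ j) {ε M C₁ : ℝ} (hε : 0 < ε) (hM : 1 ≤ M)
    (hMε : Real.exp (-(M ^ 2 / 2)) ≤ 2 * ε) (hC₁ : ∀ x, |deriv smoothTransition x| ≤ C₁) (y : ℝ) :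
    |deriv (fun y => smoothTransition ((-deriv (P.U j) y - (1 - 2 * ε)) / ε)) y| ≤
      2 * C₁ * (M + 4) * (2 * Real.pi * P.N j / P.δ j) := by
  have hdiff : Differentiable ℝ (deriv (P.U j)) := (P.contDiff_deriv_U hδ (n := 1)).differentiable (by simp)
  have hdiffn : Differentiable ℝ (fun y => -deriv (P.U j) y) := hdiff.neg
  have hL1 : 0 ≤ (M + 4) * (2 * Real.pi * P.N j / P.δ j) * (2 * ε) := by
    have : 0 ≤ M + 4 := by linarith
    positivity
  have h := abs_deriv_cutoff_le_of_layer hdiffn hε hC₁ hL1 (fun z h1 h2 => by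
    have e : deriv (fun y => -deriv (P.U j) y) z = -deriv (deriv (P.U j)) z := deriv.neg
    rw [e, abs_neg]
    exact abs_deriv2_U_le_of_layer P hδ hM hMε (s₀ := -1) (Or.inr rfl) (by linarith)) y
  calc _ ≤ _ := h
    _ = 2 * C₁ * (M + 4) * (2 * Real.pi * P.N j / P.δ j) := by field_simp

/-- **`ε`-free bound of `X⁺_j″`**: for `W = U_j′`, `0 < ε`, `M ≥ 1` with `e^{−M²/2} ≤ 2ε`:
`|(sT((U_j′ − (1−2ε))/ε))″(y)| ≤ (4C₂(M+4)² + 2C₁(2M²+33))(2πN_j/δ_j)²` for every `y`.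
[cite: ElgindiLissMattingly2025, §1 and Rmk. 1.4 (the smoothed pulse profiles)] -/
theorem abs_deriv_deriv_cutoff_deriv_U_le_of_layer {j : ℕ} (hδ : 0 < P.δ j) {ε M C₁ C₂ : ℝ} (hε : 0 < ε) (hM : 1 ≤ M)
    (hMε : Real.exp (-(M ^ 2 / 2)) ≤ 2 * ε) (hC₁ : ∀ x, |deriv smoothTransition x| ≤ C₁)
    (hC₂ : ∀ x, |deriv (deriv smoothTransition) x| ≤ C₂) (y : ℝ) :
    |deriv (deriv fun y => smoothTransition ((deriv (P.U j) y - (1 - 2 * ε)) / ε)) y| ≤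
      (4 * C₂ * (M + 4) ^ 2 + 2 * C₁ * (2 * M ^ 2 + 33)) * (2 * Real.pi * P.N j / P.δ j) ^ 2 := by
  have hdiff : Differentiable ℝ (deriv (P.U j)) := (P.contDiff_deriv_U hδ (n := 1)).differentiable (by simp)
  have hdiff2 : Differentiable ℝ (deriv (deriv (P.U j))) :=
    (contDiff_infty_iff_deriv.1 (P.contDiff_deriv_U hδ)).2.differentiable (by simp)
  have hM4 : 0 ≤ M + 4 := by linarith
  have hL1 : 0 ≤ (M + 4) * (2 * Real.pi * P.N j / P.δ j) * (2 * ε) := by positivity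
  have hL2 : 0 ≤ (2 * M ^ 2 + 33) * (2 * Real.pi * P.N j / P.δ j) ^ 2 * (2 * ε) := by positivity
  have h := abs_deriv_deriv_cutoff_le_of_layer hdiff hdiff2 hε hC₁ hC₂ hL2
    (fun z h1 h2 => abs_deriv2_U_le_of_layer P hδ hM hMε (s₀ := 1) (Or.inl rfl) (by linarith))
    (fun z h1 h2 => abs_deriv3_U_le_of_layer P hδ hM hMε (s₀ := 1) (Or.inl rfl) (by linarith)) y
  calc _ ≤ _ := h
    _ = (4 * C₂ * (M + 4) ^ 2 + 2 * C₁ * (2 * M ^ 2 + 33)) * (2 * Real.pi * P.N j / P.δ j) ^ 2 := by field_simp; ring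

/-- The same for the `−` family `W = −U_j′`. [cite: ElgindiLissMattingly2025, §1 and Rmk. 1.4 (the smoothed pulse profiles)] -/
theorem abs_deriv_deriv_cutoff_neg_deriv_U_le_of_layer {j : ℕ} (hδ : 0 < P.δ j) {ε M C₁ C₂ : ℝ} (hε : 0 < ε)
    (hM : 1 ≤ M) (hMε : Real.exp (-(M ^ 2 / 2)) ≤ 2 * ε) (hC₁ : ∀ x, |deriv smoothTransition x| ≤ C₁)
    (hC₂ : ∀ x, |deriv (deriv smoothTransition) x| ≤ C₂) (y : ℝ) :
    |deriv (deriv fun y => smoothTransition ((-deriv (P.U j) y - (1 - 2 * ε)) / ε)) y| ≤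
      (4 * C₂ * (M + 4) ^ 2 + 2 * C₁ * (2 * M ^ 2 + 33)) * (2 * Real.pi * P.N j / P.δ j) ^ 2 := by
  have hdiff : Differentiable ℝ (deriv (P.U j)) := (P.contDiff_deriv_U hδ (n := 1)).differentiable (by simp)
  have hdiff2 : Differentiable ℝ (deriv (deriv (P.U j))) :=
    (contDiff_infty_iff_deriv.1 (P.contDiff_deriv_U hδ)).2.differentiable (by simp)
  have hdiffn : Differentiable ℝ (fun y => -deriv (P.U j) y) := hdiff.neg
  have hdn : deriv (fun y => -deriv (P.U j) y) = fun y => -deriv (deriv (P.U j)) y := by funext z; exact deriv.neg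
  have hdiffn2 : Differentiable ℝ (deriv fun y => -deriv (P.U j) y) := by rw [hdn]; exact hdiff2.neg
  have hM4 : 0 ≤ M + 4 := by linarith
  have hL1 : 0 ≤ (M + 4) * (2 * Real.pi * P.N j / P.δ j) * (2 * ε) := by positivity
  have hL2 : 0 ≤ (2 * M ^ 2 + 33) * (2 * Real.pi * P.N j / P.δ j) ^ 2 * (2 * ε) := by positivity
  have h := abs_deriv_deriv_cutoff_le_of_layer hdiffn hdiffn2 hε hC₁ hC₂ hL2
    (fun z h1 h2 => by
      have e : deriv (fun y => -deriv (P.U j) y) z = -deriv (deriv (P.U j)) z := deriv.neg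
      rw [e, abs_neg]
      exact abs_deriv2_U_le_of_layer P hδ hM hMε (s₀ := -1) (Or.inr rfl) (by linarith))
    (fun z h1 h2 => by
      have e : deriv (fun y => -deriv (deriv (P.U j)) y) z = -deriv (deriv (deriv (P.U j))) z := deriv.neg
      rw [hdn, e, abs_neg]
      exact abs_deriv3_U_le_of_layer P hδ hM hMε (s₀ := -1) (Or.inr rfl) (by linarith)) y
  calc _ ≤ _ := h
    _ = (4 * C₂ * (M + 4) ^ 2 + 2 * C₁ * (2 * M ^ 2 + 33)) * (2 * Real.pi * P.N j / P.δ j) ^ 2 := by field_simp; ring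

end Summit.AnomalousDissipation.AnomalousDissipation.Theorems.SawtoothPulseCascade.K1Flat
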